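import Summits.QuantumAdvantage.QuantumAdvantage.Theses.HankelLift

/-!
# Birth skeleton (BC3) — crux `BeyondRectangles` of route `HankelLift` (stmt-QuantumAdvantage-18440)

The crux (`Summits/QuantumAdvantage/QuantumAdvantage/Theses/HankelLift.lean`, rank 3, HYPOTHESIS-TYPE, "never
staffed for proof") says: for every PPT `A` (tree `RandAlg`, `IsPolyTime id encodeBool`) there are infinitely many
`n` at which `A`'s average probability, over the uniform pair `(x, y) ∈ [2ⁿ]²` presented as
`boolPair (bitsₙ x) (bitsₙ y)`, of predicting the bit `[λ(x + y + 2) = −1]` is at most the agreement fraction of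
SOME product-partition ("rectangle") rule `(x, y) ↦ g (a x) (b y)` with `k ≤ n²` labels a side, plus `1/10`.

This skeleton TYPES the reading of the crux recorded by its author ("fails iff some PPT agrees with λ(x+y+2) on
≥ 0.6 of uniform n-bit pairs … a 0.2-correlating feasible statistic") as a three-piece CUT along the route's own
lever ("give each party a summand"):

* `stub_liouvilleBPPDark` — HARDNESS (hypothesis-type, the bet; refuters first).  The LIFT-FREE core: for every
  PPT `B` reading ONE integer `m < 2ⁿ⁺¹` (as `n + 1` bits) there are infinitely many `n` with
  `|Σ_{m<2ⁿ⁺¹} rₙ(m)·λ(m+2)·(2·Pr[B(m) = true] − 1)| ≤ 4ⁿ/6`, where `rₙ(m) = #{(x,y) ∈ [2ⁿ]² : x + y = m}` is the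
  antidiagonal multiplicity (the law of `x + y`, triangular on `[0, 2ⁿ⁺¹ − 2]`, total mass `4ⁿ`).  This is the
  average-case "Möbius/Liouville randomness principle against BPP observables" (Sarnak's P-version, which he flags
  as tied to the hardness of factoring; Kalai's AC⁰ question = Green / Bourgain is its bounded-depth rung), with the
  smooth triangular weight and a CONSTANT correlation `1/6`; it mentions neither pairs, nor rectangles, nor the
  language `L⁺`, and alone bounds no success probability of a PAIR predictor.
* `stub_antidiagonalSampling` — COMPLEXITY GLUE (true in every standard model; in the tree L–XL: a sampler machine
  composed with `A` via `PolyTimeComputable.comp_holds`).  The sum-lift is TRANSPARENT to PPT: for every PPT `A` on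
  pairs there is a PPT `B` on sums with `|pairCorr A n − sumCorr B n| ≤ 4ⁿ/30` for EVERY `n` — `B(m)`: rejection-
  sample `x` on the antidiagonal `{(x, m − x)} ∩ [2ⁿ]²` (6 rounds, failure `≤ 2⁻⁶ < 1/60`), run `A(x, m − x)`; then
  `2·Pr[B(m)=true] − 1` is the antidiagonal mean of `2·Pr[A=true] − 1` up to `2·2⁻⁶`, and `Σ_m rₙ(m)·(2/64) ≤ 4ⁿ/30`.
  This is exactly where the route's lever lives: for RECTANGLES the split `m = x + y` is opaque (that is what makes
  `HankelDiscrepancy` a theorem), for BPP it is invisible — so the hypothesis of the route is lift-independent.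
* `stub_successCalibration` — ARITHMETIC-OF-PROBABILITY GLUE (true, size M): for every randomized `A` (no
  efficiency needed) and every `n`, `successSum A n = 4ⁿ/2 − pairCorr A n / 2` EXACTLY: `enc` is injective on
  `[2ⁿ]²` (so `enc(x,y) ∈ L⁺ ↔ λ(x+y+2) = −1`), `Pr[A = false] = 1 − Pr[A = true]` (`RandAlg.pr` is the mass of
  the `PMF` `outputPMF`), `λ(x+y+2) ∈ {±1}` (`x + y + 2 ≠ 0`), and per pair
  `Pr[correct] = 1/2 − λ·(2·Pr[true] − 1)/2`.
* proved here (no sorry): `card_pairs` (`#[2ⁿ]² = 4ⁿ`), `rectangleBaseline` (for `n ≥ 1` one of the two CONSTANT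
  rules — which are rectangle rules with `k = 1 ≤ n²` — agrees on at least half of the pairs), the restatement
  `beyondRectangles_iff` (`Iff.rfl` over the named objects) and the composition `BeyondRectangles_of`:
  dark ∧ sampling ⇒ `|pairCorr| ≤ 4ⁿ/6 + 4ⁿ/30 = 4ⁿ/5` infinitely often (and `n ≥ 1` there, `Frequently.and_eventually`);
  calibration ⇒ `successSum ≤ (3/5)·4ⁿ`; baseline ⇒ `3/5 = 1/2 + 1/10 ≤ agreement + 1/10`.

Separation strength (crux ∧ `LiouvilleSumMemBQP` ∧ the theorem-side items ⇒ BQP ⊄ BPP;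
`Literature.Barriers.QuantumAdvantage.SeparationPrerequisites`) is carried by `stub_liouvilleBPPDark` JOINTLY with
`stub_antidiagonalSampling` and by neither alone (the dark stub speaks of single-integer predictors under the
triangular law and says nothing about `L⁺`; the sampling stub is a true reduction).  `Relativization` /
`Algebrization` / `NaturalProofs(‑Narrow)` / `QuantumNaturalProofs`: not engaged — no proof technique is proposed for
the hypothesis-type stub (it is a hardness-of-one-language statement of shape (R2a), false in every collapsing world,
as `BQPRelativizationNarrow` demands); stubs 2–3 are a machine composition and finite probability bookkeeping.

Disproof used: none exists (`ledger crux ls stmt-QuantumAdvantage-18440`: no workfiles, no `Disproof.lean`, no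
`Theorems/BeyondRectangles/Negative/*`, 2026-08-17).  Negatives index (`ledger negatives --problem QuantumAdvantage`,
6 refuted statements: RegulatorThird, ShorLocallyDark, CubicStability, SpinorFlattening, KummerSector,
SeparableFrames): none concerns λ/μ, sumsets or average-case prediction of an arithmetic sign, so no stub restates a
refuted statement.  BC3 probes (`bc/BeyondRectangles_probe.lean` of the registering seat: imports only the route
file, re-declares the named objects, so this file's composition is not in scope; farm `lean check`, `maxHeartbeats
400000` each): for each of the three stub statements `S`, `S → BeyondRectangles` and `S → QuantumAdvantage` FAIL by
`first | exact? | simpa | simpa [S, defs, target] | (unfold S target; simpa) | aesop` — 6/6 "unsolved goals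
⊢ BeyondRectangles | ⊢ QuantumAdvantage" after "aesop: failed to prove the goal after exhaustive search" (so `exact?`
and both `simpa`s failed before it), while the controls `example : S := by sorry` elaborate (the probes fail on
content, not syntax).  No stub is cheaply the crux or the summit.

Numerics caveat for refuters (stub 1 is ASYMPTOTIC): the trial-division statistic `λ(z-smooth part of m+2)` has
correlation `= mean of λ(z-rough part)`, which decays only like a power of `log z / log N = O(log n / n)` (Wirsing–Halász
/ Hall–Tenenbaum; Euler-product heuristic `(log z/log N)²`), so at kit scale (`n ≤ 64`, `z = n³`) correlations
`≈ 0.05–0.1` from trial division alone are expected and are NOT refutations; a refutation is a statistic whose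
correlation does not tend to `0` along any subsequence.

`sorry` occurs ONLY in the three `stub_*` theorems.
-/

-- `Summit.<Summit>.<Problem>`: the duplicate `QuantumAdvantage.QuantumAdvantage` is mandated.
set_option linter.dupNamespace false

noncomputable section

namespace Summit.QuantumAdvantage.QuantumAdvantage.Cruxes.BeyondRectangles.Birth

-- Same scopes as the route file, so that the copied sub-terms of the crux elaborate to the very same terms
-- (in particular the same `Decidable` instances inside `Finset.filter`), making `beyondRectangles_iff` an `Iff.rfl`.
open scoped BigOperators Topology Manifold Classical MeasureTheory ProbabilityTheory Matrix InnerProductSpace ComplexConjugate ContinuousMap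
open Filter Set Function TopologicalSpace MeasureTheory
open Literature.QuantumAdvantage
open Literature.Computability.Complexity (RandAlg)
open Summit.QuantumAdvantage.QuantumAdvantage.Theses.HankelLift (BeyondRectangles)

/-! ## The objects of the crux, named (verbatim sub-terms of the route decl `BeyondRectangles`) -/

/-- The pair encoding of the crux: `enc n x y = boolPair (bitsₙ x) (bitsₙ y)` (little-endian `n`-bit blocks).
[folklore] -/
def enc (n x y : ℕ) : List Bool :=
  Literature.Computability.Complexity.boolPair (List.ofFn fun i : Fin n => Nat.testBit x i)
    (List.ofFn fun i : Fin n => Nat.testBit y i)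

/-- The lifted Liouville language `L⁺ = {enc n x y : x, y < 2ⁿ, λ(x + y + 2) = −1}` (the `L` of the crux).
[folklore] -/
def liftLang : Language Bool :=
  {w | ∃ n x y : ℕ, x < 2 ^ n ∧ y < 2 ^ n ∧ w = enc n x y ∧ ArithmeticFunction.liouville (x + y + 2) = -1}

/-- Total success of `A` at level `n`: `Σ_{(x,y) ∈ [2ⁿ]²} Pr[A(enc n x y) = [enc n x y ∈ L⁺]]` (verbatim the
numerator of the crux's left-hand side). [cite: BogdanovTrevisan2006, Def. 2.13] -/
def successSum (A : RandAlg (List Bool) Bool) (n : ℕ) : ℝ :=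
  ∑ p ∈ (Finset.univ : Finset (Fin (2 ^ n) × Fin (2 ^ n))),
    A.pr id (enc n p.1 p.2) {Set.boolIndicator liftLang (enc n p.1 p.2)}

/-- Agreement count of the product-partition ("rectangle") rule `(x, y) ↦ g (a x) (b y)` with the Hankel sign
pattern `[λ(x + y + 2) = −1]` on `[2ⁿ]²` (verbatim the numerator of the crux's right-hand side).
[cite: KushilevitzNisan1997, §1.2] -/
def agreeCount (n k : ℕ) (a b : Fin (2 ^ n) → Fin k) (g : Fin k → Fin k → Bool) : ℕ :=
  (Finset.univ.filter fun p : Fin (2 ^ n) × Fin (2 ^ n) =>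
    g (a p.1) (b p.2) = decide (ArithmeticFunction.liouville (p.1.val + p.2.val + 2) = -1)).card

/-- The Hankel sign pattern `λ(x + y + 2) ∈ {±1}` as a real number. [folklore] -/
def hankelSign (n : ℕ) (p : Fin (2 ^ n) × Fin (2 ^ n)) : ℝ :=
  ((ArithmeticFunction.liouville (p.1.val + p.2.val + 2) : ℤ) : ℝ)

/-- Acceptance probability `t_A(x, y) = Pr_r[A(enc n x y; r) = true]`. [cite: AroraBarak2009, §7.1] -/
def accept (A : RandAlg (List Bool) Bool) (n : ℕ) (p : Fin (2 ^ n) × Fin (2 ^ n)) : ℝ :=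
  A.pr id (enc n p.1 p.2) {true}

/-- PAIR correlation of `A`'s mean output with the Hankel pattern at level `n`:
`pairCorr A n = Σ_{(x,y) ∈ [2ⁿ]²} λ(x + y + 2)·(2·t_A(x, y) − 1) ∈ [−4ⁿ, 4ⁿ]`. [folklore] -/
def pairCorr (A : RandAlg (List Bool) Bool) (n : ℕ) : ℝ :=
  ∑ p ∈ (Finset.univ : Finset (Fin (2 ^ n) × Fin (2 ^ n))), hankelSign n p * (2 * accept A n p - 1)

/-- Antidiagonal multiplicity `rₙ(m) = #{(x, y) ∈ [2ⁿ]² : x + y = m}` — the law of the sum of two independent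
uniform `n`-bit integers (times `4ⁿ`): `min(m + 1, 2ⁿ⁺¹ − 1 − m)` on `[0, 2ⁿ⁺¹ − 2]`, else `0`. [folklore] -/
def antidiag (n m : ℕ) : ℕ :=
  ((Finset.univ : Finset (Fin (2 ^ n) × Fin (2 ^ n))).filter fun p => p.1.val + p.2.val = m).card

/-- The `(n+1)`-bit little-endian encoding of a sum `m < 2ⁿ⁺¹` (the input of the single-integer predictor `B`;
its length tells `B` the level `n`). [folklore] -/
def encSum (n m : ℕ) : List Bool :=
  List.ofFn fun i : Fin (n + 1) => Nat.testBit m i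

/-- SUM correlation of a single-integer predictor `B` with the shifted Liouville function under the triangular
law: `sumCorr B n = Σ_{m < 2ⁿ⁺¹} rₙ(m)·λ(m + 2)·(2·Pr[B(encSum n m) = true] − 1) ∈ [−4ⁿ, 4ⁿ]`. [folklore] -/
def sumCorr (B : RandAlg (List Bool) Bool) (n : ℕ) : ℝ :=
  ∑ m ∈ Finset.range (2 ^ (n + 1)),
    (antidiag n m : ℝ) * ((ArithmeticFunction.liouville (m + 2) : ℤ) : ℝ) * (2 * B.pr id (encSum n m) {true} - 1)

/-! ## The three registered stubs (the ONLY sorries) -/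

/-- **Stub 1 — `stub_liouvilleBPPDark` (HARDNESS; hypothesis-type, the bet of the line; refuters first, never a
proving target).**  Lift-free average-case Liouville randomness against BPP observables: for every probabilistic
polynomial-time `B` reading one integer `m` as `n + 1` bits there are infinitely many `n` with
`|Σ_{m<2ⁿ⁺¹} rₙ(m)·λ(m+2)·(2·Pr[B(m)=true] − 1)| ≤ 4ⁿ/6` (correlation `≤ 1/6` under the triangular law of `x + y`).
Why plausibly true: it is the average-case, constant-correlation form of "λ is orthogonal to every polynomial-time
observable" (Sarnak's P-version of Möbius randomness; its AC⁰ rung is Green's theorem `arXiv:1103.4991`, its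
bounded-depth-with-parity rung Bourgain's); a `1/6`-correlating PPT statistic of `m` would predict the parity of
`Ω(m+2)` on a `7/12` fraction of a smooth positive-density set of integers, which every known method does only
through factoring (fully factorable `m` have density `O((log n)²/n)`; smooth-part statistics correlate `≪ e^{−c√n}`).
Why it might fail: exactly the crux's recorded risk — a factoring-free feasible statistic correlating with `λ` on
average (it is average-case, hence STRONGER than worst-case `λ ∉ BPP`).  Kept in the crux's own weak `∃ᶠ n` form;
asymptotic only (trial division to `z = poly(n)` correlates `≍ (log z/log N)^{c} → 0` merely polynomially in `log n/n`).
Nearest print form: Pudlák, arXiv:1210.4692, Definition 2 + §2.3 ("pseudorandom" = uncorrelated with every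
polynomial-time `f : ℕ → {±1}`; "μ is pseudorandom iff λ is"; the AC⁰ rung is Green's theorem; "if μ is
pseudorandom then integers cannot be factored in polynomial time") — this stub is its randomized, triangular-weight,
constant-correlation, infinitely-often variant.
Sources: Sarnak2010 (Lecture 1), Kalai2011, arXiv:1103.4991, arXiv:1210.4692 (Def. 2), BogdanovTrevisan2006
(Def. 2.13), Literature.Barriers.QuantumAdvantage.SeparationPrerequisites.
[cite: Sarnak2010, Lecture 1] [cite: arXiv:1210.4692, Def. 2] [cite: BogdanovTrevisan2006, Def. 2.13] -/
theorem stub_liouvilleBPPDark :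
    ∀ B : RandAlg (List Bool) Bool, B.IsPolyTime id Computability.encodeBool →
      ∃ᶠ n : ℕ in Filter.atTop, |sumCorr B n| ≤ (4 : ℝ) ^ n / 6 := by
  sorry

/-- **Stub 2 — `stub_antidiagonalSampling` (COMPLEXITY GLUE; true in every standard model, L–XL in the tree).**
The sum-lift is transparent to PPT: for every PPT `A` on encoded pairs there is a PPT `B` on encoded sums such that
`|pairCorr A n − sumCorr B n| ≤ 4ⁿ/30` for every `n`.  Construction: on input `encSum n m`, `B` rejection-samples
`x` uniformly from the antidiagonal `{x : x < 2ⁿ, m − x < 2ⁿ}` (an interval of length `rₙ(m) ≥ 1`; 6 rounds, each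
drawing `⌈log₂ rₙ(m)⌉ ≤ n` coins and accepting when the value is `< rₙ(m)`, so each round accepts with probability
`> 1/2` and the failure probability is `≤ 2⁻⁶`), and runs `A` on `enc n x (m − x)` with fresh coins (output `false`
on sampling failure);
then `|(2·Pr[B(m)=true] − 1) − rₙ(m)⁻¹·Σ_{x+y=m}(2·t_A(x,y) − 1)| ≤ 2·2⁻⁶` and, regrouping `pairCorr` along
antidiagonals (`λ(x+y+2)` is constant on each), the two correlations differ by at most `Σ_m rₙ(m)/32 = 4ⁿ/32`.
Why it might fail as typed: only through the tree's machine model (composition `PolyTimeComputable.comp_holds`,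
coin budget as a function of the input length `n + 1`, totality of `run` on short coin strings — all available or
routine); mathematically it is a two-line sampling argument.  Sources: AroraBarak2009 (§7.1, Def. 7.1–7.3),
BogdanovTrevisan2006 (§2, samplable ensembles), Goldreich 2001 §1.3.2.
[cite: AroraBarak2009, §7.1] [cite: BogdanovTrevisan2006, §2] -/
theorem stub_antidiagonalSampling :
    ∀ A : RandAlg (List Bool) Bool, A.IsPolyTime id Computability.encodeBool →
      ∃ B : RandAlg (List Bool) Bool, B.IsPolyTime id Computability.encodeBool ∧
        ∀ n : ℕ, |pairCorr A n - sumCorr B n| ≤ (4 : ℝ) ^ n / 30 := by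
  sorry

/-- **Stub 3 — `stub_successCalibration` (PROBABILITY GLUE; true, size M, no efficiency hypothesis on `A`).**
For every randomized `A` and every level `n`, `successSum A n = 4ⁿ/2 − pairCorr A n / 2`: per pair,
`Pr[A correct] = Pr[true]` if `λ = −1` and `= Pr[false] = 1 − Pr[true]` if `λ = +1`, i.e.
`= 1/2 − λ·(2·Pr[true] − 1)/2`; sum over the `4ⁿ` pairs.  Ingredients: `RandAlg.pr` is the mass of the PMF
`outputPMF`, so `Pr[false] = 1 − Pr[true]`; `enc n` is injective on `[2ⁿ]²` and the block length determines `n`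
(`boolPair_injective`, `List.ofFn_inj`, `Nat.eq_of_testBit_eq`), so `enc n x y ∈ L⁺ ↔ λ(x+y+2) = −1`, i.e.
`Set.boolIndicator L⁺ (enc n x y) = decide (λ(x+y+2) = −1)`; `λ(x+y+2) = (−1)^{Ω(x+y+2)} ∈ {±1}`
(`ArithmeticFunction.liouville_apply`, `x + y + 2 ≠ 0`); `#[2ⁿ]² = 4ⁿ` (`card_pairs`).
Sources: BogdanovTrevisan2006 (Def. 2.13, average-case success vs. correlation), AroraBarak2009 (§7.1); folklore
(predictor advantage = correlation / 2).
[cite: BogdanovTrevisan2006, Def. 2.13] [cite: AroraBarak2009, §7.1] -/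
theorem stub_successCalibration :
    ∀ (A : RandAlg (List Bool) Bool) (n : ℕ), successSum A n = (4 : ℝ) ^ n / 2 - pairCorr A n / 2 := by
  sorry

/-! ## Name-keyed aliases of the stub statements (hypotheses of the composition; A12 skeleton audit: the
composition's hypotheses must be registered obligations or declared stubs BY NAME).  Each abbrev is the
corresponding `stub_*` statement verbatim. -/

namespace Registered

/-- Alias of stub 1's statement (lift-free Liouville darkness against BPP, triangular law, `∃ᶠ n`), keyed by the
registered stub name. [folklore] -/
abbrev stub_liouvilleBPPDark : Prop :=
  ∀ B : RandAlg (List Bool) Bool, B.IsPolyTime id Computability.encodeBool →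
    ∃ᶠ n : ℕ in Filter.atTop, |sumCorr B n| ≤ (4 : ℝ) ^ n / 6

/-- Alias of stub 2's statement (antidiagonal sampling: pair correlation = sum correlation up to `4ⁿ/30`), keyed
by the registered stub name. [folklore] -/
abbrev stub_antidiagonalSampling : Prop :=
  ∀ A : RandAlg (List Bool) Bool, A.IsPolyTime id Computability.encodeBool →
    ∃ B : RandAlg (List Bool) Bool, B.IsPolyTime id Computability.encodeBool ∧
      ∀ n : ℕ, |pairCorr A n - sumCorr B n| ≤ (4 : ℝ) ^ n / 30

/-- Alias of stub 3's statement (success = half minus half the pair correlation), keyed by the registered stub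
name. [folklore] -/
abbrev stub_successCalibration : Prop :=
  ∀ (A : RandAlg (List Bool) Bool) (n : ℕ), successSum A n = (4 : ℝ) ^ n / 2 - pairCorr A n / 2

end Registered

/-! ## Proved pieces (no sorry): counting, the constant-rule baseline, the restatement -/

/-- `#([2ⁿ] × [2ⁿ]) = 4ⁿ`. [folklore] -/
theorem card_pairs (n : ℕ) : (Finset.univ : Finset (Fin (2 ^ n) × Fin (2 ^ n))).card = 4 ^ n := by
  rw [Finset.card_univ, Fintype.card_prod, Fintype.card_fin, ← mul_pow]
  norm_num

/-- **Constant rules are rectangle rules (the baseline, PROVED).**  For `n ≥ 1` there is a product-partition rule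
with `k = 1 ≤ n²` labels a side agreeing with `[λ(x+y+2) = −1]` on at least half of `[2ⁿ]²`: the two constant
rules `g ≡ true`, `g ≡ false` partition the pairs between them, so one of them agrees on `≥ 4ⁿ/2`.
[cite: KushilevitzNisan1997, §1.2] -/
theorem rectangleBaseline (n : ℕ) (hn : 1 ≤ n) :
    ∃ k : ℕ, k ≤ n ^ 2 ∧ ∃ (a b : Fin (2 ^ n) → Fin k) (g : Fin k → Fin k → Bool),
      (4 : ℝ) ^ n ≤ 2 * (agreeCount n k a b g : ℝ) := by
  -- the label pattern
  let P : Fin (2 ^ n) × Fin (2 ^ n) → Bool := fun p =>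
    decide (ArithmeticFunction.liouville (p.1.val + p.2.val + 2) = -1)
  have hk : 1 ≤ n ^ 2 := Nat.one_le_pow _ _ hn
  -- the two constant rules partition the pairs
  have hpart : (Finset.univ.filter fun p => true = P p).card
      + (Finset.univ.filter fun p => false = P p).card = 4 ^ n := by
    have h1 : (Finset.univ.filter fun p : Fin (2 ^ n) × Fin (2 ^ n) => false = P p)
        = Finset.univ.filter fun p => ¬ (true = P p) := by
      refine Finset.filter_congr ?_
      intro p _
      cases P p <;> simp
    rw [h1, Finset.card_filter_add_card_filter_not, card_pairs]
  have hconst : ∀ c : Bool, agreeCount n 1 (fun _ => 0) (fun _ => 0) (fun _ _ => c)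
      = (Finset.univ.filter fun p => c = P p).card := fun c => rfl
  by_cases h : 4 ^ n ≤ 2 * (Finset.univ.filter fun p => true = P p).card
  · refine ⟨1, hk, fun _ => 0, fun _ => 0, fun _ _ => true, ?_⟩
    rw [hconst]
    exact_mod_cast h
  · refine ⟨1, hk, fun _ => 0, fun _ => 0, fun _ _ => false, ?_⟩
    rw [hconst]
    have h' : 4 ^ n ≤ 2 * (Finset.univ.filter fun p => false = P p).card := by omega
    exact_mod_cast h'

/-- The crux, restated over the named objects: `BeyondRectangles` is by `Iff.rfl` (ζ-reduction of its two `let`s,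
β-reduction, and δ-unfolding of `enc`, `liftLang`, `successSum`, `agreeCount`) the statement that every PPT has,
infinitely often, average success at most the agreement fraction of some rectangle rule with `k ≤ n²` plus `1/10`.
[folklore] -/
theorem beyondRectangles_iff :
    BeyondRectangles ↔
      ∀ A : RandAlg (List Bool) Bool, A.IsPolyTime id Computability.encodeBool →
        ∃ᶠ n : ℕ in Filter.atTop, ∃ k : ℕ, k ≤ n ^ 2 ∧
          ∃ (a b : Fin (2 ^ n) → Fin k) (g : Fin k → Fin k → Bool),
            successSum A n / ((Finset.univ : Finset (Fin (2 ^ n) × Fin (2 ^ n))).card : ℝ) ≤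
              (agreeCount n k a b g : ℝ) / ((Finset.univ : Finset (Fin (2 ^ n) × Fin (2 ^ n))).card : ℝ)
                + 1 / 10 :=
  Iff.rfl

/-! ## Kernel-checked composition (no sorry) -/

/-- **COMPOSITION (real proof): the three stubs give the crux `BeyondRectangles` BY NAME.**  Given a PPT `A`,
stub 2 yields a PPT `B` on sums whose sum correlation tracks `A`'s pair correlation within `4ⁿ/30` at every level;
stub 1 applied to `B` yields infinitely many levels with `|sumCorr B n| ≤ 4ⁿ/6`, hence `|pairCorr A n| ≤ 4ⁿ/5`
there (and `n ≥ 1`, `Frequently.and_eventually`); stub 3 turns this into `successSum A n ≤ (3/5)·4ⁿ`, and the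
proved baseline supplies a rectangle rule with `k ≤ n²` agreeing on `≥ 4ⁿ/2` pairs, so
`success ≤ 1/2 + 1/10 ≤ agreement + 1/10`.  The seam is the triangle inequality and two divisions by `4ⁿ`; the
content is the CUT (lift-free Liouville darkness ∧ antidiagonal sampling ∧ calibration).
[cite: BogdanovTrevisan2006, Def. 2.13] -/
theorem BeyondRectangles_of (h₁ : Registered.stub_liouvilleBPPDark) (h₂ : Registered.stub_antidiagonalSampling)
    (h₃ : Registered.stub_successCalibration) : BeyondRectangles := by
  refine beyondRectangles_iff.2 fun A hA => ?_
  obtain ⟨B, hB, hAB⟩ := h₂ A hA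
  refine ((h₁ B hB).and_eventually (Filter.eventually_ge_atTop 1)).mono ?_
  rintro n ⟨hdark, hn⟩
  obtain ⟨k, hk, a, b, g, hbase⟩ := rectangleBaseline n hn
  refine ⟨k, hk, a, b, g, ?_⟩
  have hcard : ((Finset.univ : Finset (Fin (2 ^ n) × Fin (2 ^ n))).card : ℝ) = (4 : ℝ) ^ n := by
    rw [card_pairs]; push_cast; rfl
  have hpos : (0 : ℝ) < (4 : ℝ) ^ n := by positivity
  have hcorr : |pairCorr A n| ≤ (4 : ℝ) ^ n / 5 := by
    have htri := abs_sub_abs_le_abs_sub (pairCorr A n) (sumCorr B n)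
    have hn' := hAB n
    linarith
  have hsucc : successSum A n ≤ 3 / 5 * (4 : ℝ) ^ n := by
    have hcal := h₃ A n
    have habs := neg_abs_le (pairCorr A n)
    linarith
  rw [hcard]
  have h1 : successSum A n / (4 : ℝ) ^ n ≤ 3 / 5 := by
    rw [div_le_iff₀ hpos]; linarith
  have h2 : (1 : ℝ) / 2 ≤ (agreeCount n k a b g : ℝ) / (4 : ℝ) ^ n := by
    rw [le_div_iff₀ hpos]; linarith
  linarith

/-- Consistency check only (an `example`, so no sorry-tainted proof of the crux enters the environment and a later
`exact?` probe importing this file cannot pick one up): the composition typechecks against the stubs exactly as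
registered. -/
example : BeyondRectangles :=
  BeyondRectangles_of stub_liouvilleBPPDark stub_antidiagonalSampling stub_successCalibration

end Summit.QuantumAdvantage.QuantumAdvantage.Cruxes.BeyondRectangles.Birth

end
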